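/-
Copyright: b2b-lace packet (explicit-unit carver, gen 18).  FRAME-LEVEL, WHAT-IF composite line (LEMMAS §24 N67-S1):
'TYPED-FRAME, two engines verdict-equal, A ≤ B in f (cause R′-min, R261), numerically UNDISCHARGED (no `RemValid 10`
instance)' — never 'certified'; no dimension sentence; no instance; record untouched.
-/
import Literature.Probability.FitznerVanDerHofstad2017.NoGoFrame
import HarnessLib

/-!
# The composite `WBX(M)` Stage-1 cell as a re-interpretation of the record frame's slot `c 0`

CITATION HEADER (PLACEMENT v2). This module is part of a certified REPRODUCTION of:
R. Fitzner, R. van der Hofstad, *Mean-field behavior for nearest-neighbor percolation in d > 10*,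
Electron. J. Probab. 22 (2017), no. 43, 1–65 [FvdH17], and *Generalized approach to the non-backtracking
lace expansion*, Probab. Theory Related Fields 169 (2017), 1041–1119 [NoBLE17-I] (arXiv:1506.07977, 1506.07969).
Reproduces: the WIRING of the notebook `Percolation.nb` cells 13–15 and 46–56 ([NoBLE17-I] Def. 2.9, (2.7): the set
`𝒮` of weighted diagrams is ANY finite set) for the variant in which the sixth bootstrap triple `(1,6,{0})` is replaced
by `(1,M+1,{0})` and the weighted bubble at level `6` is bounded by the explicit pieces `i = 6..M` plus the tail
`(2d z)^{M+1−6} c_{1,M+1,{0}} Γ₃` (HOME/b2b-lace-enum1/g4/WBX.md (E4); oracle-level soundness: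
`WeightedBubbleSkeletonF3.tsum_sq_weighted_repBubble_le_skeleton_tau_of_nobleFOf_le`).  Origin: build `lace`, node
N67-S1 of `LEMMAS.md` §24; spec `HOME/carver/g18/N67-S-SPEC.md`.

## The carving (why no new atom, state or frame is needed)

In the record's typed Stage 1 the weight `c 0 = c_{1,6,{0}}Γ₃` is read by exactly one term, `Stage1Cells.wb6`
(`Bound[WeightedBubble,6,s]/(2dz)^k = w^{6−k}·cw 0`), and cell 15's `wb5/wb4/wb3` are `wb6 +` explicit pieces.  In
`NoGoFrame`, `State.c` enters `Frame.T`/`Frame.Closes` only through `c := max initCell cellT` and the checks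
`Closes.f3init/f3`.  Hence the composite cell is the RECORD frame `Φ` at a state whose slot `c 0` is no longer a
bootstrap constant but dominates the DERIVED bound `B6 pieces M y c₆` (below), with the two `j = 0` checks dropped and
the new triple's own initial/improvement checks `initLast M < c₆`, `cellLast M y < c₆` added (`ClosesWBX`).

## What is here (all over an abstract frame `Φ : Frame ν`, abstract explicit pieces `pieces : State → ℕ → ℝ`, symbolic `M`)

* `Frame.B6`, `Frame.cellLast`, `Frame.cellLast'` (M3-minorant form), `Frame.initLast`, `Frame.ClosesWBX`;
* `closesWBX_of_closes` / `ClosesWBX.closes` (the record's closing predicate and the composite one differ exactly by the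
  slot-0 fields), `ClosesWBX.adm`-free order facts: `cellLast'_mono`, `cellLast'_le_cellLast` (the `cells_mono` pattern of
  `NoGoFrame` for the new cell), `B6_mono_c`.

## What is NOT here
No explicit pieces (N67-S3), no SRW tables beyond the record's (N67-S2), no numerals, no dimension, no instance, no
no-go box theorem for the composite cell (it needs a floor for `c₆` and the pieces' monotonicity: successors).  NOTHING
in this module is a cited hypothesis; `pieces` is a PARAMETER.  Record files `NobleInstantiate`/`NobleAssumptions`/
`MeanFieldD11Cert`/`Stage1Cells`/`Stage1Frame`/`NoGoFrame` untouched.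

## References
* [NoBLE17-I] R. Fitzner, R. van der Hofstad, PTRF 169 (2017) 1041–1119; arXiv:1506.07969 — Def. 2.9, (2.7), §3.4.
* [FvdH17] R. Fitzner, R. van der Hofstad, EJP 22 (2017) no. 43; notebook `Percolation.nb` cells 13–15, 46–56.
-/

noncomputable section

namespace Literature.Probability.FitznerVanDerHofstad2017

namespace NoGoFrame

open BetaMap F3Bounds Literature.Barriers.CriticalPhenomena

namespace Frame

section Defs

variable {ν : Type*} (Φ : Frame ν)

/-- The DERIVED slot-0 bound of the composite line, normalised like `cw 0` (i.e. divided by `(2d z_o)^6`):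
`B6 = Σ_{i=6}^{M} (2d z_o)^{i−6}·piece_i(y) + (2d z_o)^{M+1−6}·c₆` (WBX.md (E4) at `m = 6`, `Γ₃ = 1`).
[cite: FitznerVanDerHofstad2016NoBLE, (2.7) and Def. 2.9, PTRF pp. 1058–1060] -/
def B6 (pieces : State → ℕ → ℝ) (M : ℕ) (y : State) (c₆ : ℝ) : ℝ :=
  (∑ i ∈ Finset.Icc 6 M, (2 * Φ.d * Φ.zo y) ^ (i - 6) * pieces y i) + (2 * Φ.d * Φ.zo y) ^ (M + 1 - 6) * c₆

/-- The improvement cell of the NEW triple `(1, M+1, {0})`, computed two ways exactly as `cells` 0 does for `(1,6,{0})`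
(`min (B 1 (M+1) n0 []) (B 1 M n1 [])`, WBX.md T₁₀). [cite: FitznerVanDerHofstad2017, notebook Percolation.nb cells 49–54] -/
def cellLast (M : ℕ) (y : State) : ℝ :=
  min (boundFThree Φ.τ 1 (M + 1) Φ.n0 [] (Φ.argsWith y (Φ.exAt y Pt.o 1)))
    (boundFThree Φ.τ 1 M Φ.n1 [] (Φ.argsWith y (Φ.exAt y Pt.o 1)))

/-- The M3-minorant form of `cellLast` (`boundFThreeMono`, `afmax` slot filled by `AF y`), as `cellT'` is to `cellT`. [folklore] -/
def cellLast' (AF : State → ℝ) (M : ℕ) (y : State) : ℝ :=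
  min (boundFThreeMono Φ.τ 1 (M + 1) Φ.n0 [] (Φ.argsWith y (AF y)))
    (boundFThreeMono Φ.τ 1 M Φ.n1 [] (Φ.argsWith y (AF y)))

/-- The initial-point cell of the new triple: `BoundFThreeInital(d,1,M+1,1,{{0}})`. [cite: FitznerVanDerHofstad2017, notebook Percolation.nb cell 48] -/
def initLast (M : ℕ) : ℝ := Φ.initAt 1 (M + 1) Φ.n0 []

/-- "The composite constants CLOSE the bootstrap at `(y, c₆)`": the record's `Closes y` with the two `j = 0` f₃-checks
dropped (slot 0 is no longer a bootstrap function), the slot-0 domination `B6 ≤ y.c 0`, and the new triple's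
initial/improvement checks. [cite: FitznerVanDerHofstad2016NoBLE, Def. 2.9, PTRF p. 1060] -/
structure ClosesWBX (pieces : State → ℕ → ℝ) (M : ℕ) (y : State) (c₆ : ℝ) : Prop where
  stage1 : Φ.U y
  m_lt_one : y.m < 1
  one_lt_Gamma1 : 1 < y.Gamma1
  one_lt_Gamma2 : 1 < y.Gamma2
  m_pos : 0 < y.m
  muMin_nonneg : ∀ s, 0 ≤ ((Φ.S y).inp s).muMin
  tmp2_lt_one : ∀ s, Φ.tmp2At y s < 1
  kapPsi_lt_one : ∀ s, Φ.kap * (Φ.betaAt y s).βΨ < 1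
  techI : ∀ s, 0 < Φ.techI y s
  techIII : ∀ s, Φ.techIII y s < 1
  f1part1 : ∀ s, Φ.part1 y s < y.Gamma1
  f1part2 : ∀ s, Φ.mlow y s < y.m
  f2pos : ∀ s, 0 < Φ.F2 y s
  f2 : ∀ s, Φ.F2 y s < y.Gamma2
  /-- the five surviving initial-point checks `j = 1..5` -/
  f3init : ∀ j, j ≠ 0 → Φ.initCell j < y.c j
  /-- the five surviving improvement checks `j = 1..5` -/
  f3 : ∀ j, j ≠ 0 → Φ.cellT y j < y.c j
  /-- slot 0 dominates the derived weighted-bubble bound -/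
  slot0 : Φ.B6 pieces M y c₆ ≤ y.c 0
  /-- the new triple's initial-point check -/
  f3initLast : Φ.initLast M < c₆
  /-- the new triple's improvement check -/
  f3Last : Φ.cellLast M y < c₆

end Defs

section Proofs

variable {ν : Type*} {Φ : Frame ν} {y₀ : State} {m₂ : ℝ}

/-- The cheap direction the engines test: a tuple closing the RECORD cell, whose slot 0 dominates `B6` and whose extra
coordinate passes the new triple's two checks, closes the composite cell. [folklore] -/
theorem closesWBX_of_closes {pieces : State → ℕ → ℝ} {M : ℕ} {y : State} {c₆ : ℝ} (hC : Φ.Closes y)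
    (h0 : Φ.B6 pieces M y c₆ ≤ y.c 0) (hi : Φ.initLast M < c₆) (hl : Φ.cellLast M y < c₆) :
    Φ.ClosesWBX pieces M y c₆ where
  stage1 := hC.stage1
  m_lt_one := hC.m_lt_one
  one_lt_Gamma1 := hC.one_lt_Gamma1
  one_lt_Gamma2 := hC.one_lt_Gamma2
  m_pos := hC.m_pos
  muMin_nonneg := hC.muMin_nonneg
  tmp2_lt_one := hC.tmp2_lt_one
  kapPsi_lt_one := hC.kapPsi_lt_one
  techI := hC.techI
  techIII := hC.techIII
  f1part1 := hC.f1part1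
  f1part2 := hC.f1part2
  f2pos := hC.f2pos
  f2 := hC.f2
  f3init j _ := hC.f3init j
  f3 j _ := hC.f3 j
  slot0 := h0
  f3initLast := hi
  f3Last := hl

/-- Conversely, a composite-closing tuple whose slot 0 ALSO passes the record's two dropped checks closes the record
cell. [folklore] -/
theorem ClosesWBX.closes {pieces : State → ℕ → ℝ} {M : ℕ} {y : State} {c₆ : ℝ} (hW : Φ.ClosesWBX pieces M y c₆)
    (h0i : Φ.initCell 0 < y.c 0) (h0 : Φ.cellT y 0 < y.c 0) : Φ.Closes y where
  stage1 := hW.stage1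
  m_lt_one := hW.m_lt_one
  one_lt_Gamma1 := hW.one_lt_Gamma1
  one_lt_Gamma2 := hW.one_lt_Gamma2
  m_pos := hW.m_pos
  muMin_nonneg := hW.muMin_nonneg
  tmp2_lt_one := hW.tmp2_lt_one
  kapPsi_lt_one := hW.kapPsi_lt_one
  techI := hW.techI
  techIII := hW.techIII
  f1part1 := hW.f1part1
  f1part2 := hW.f1part2
  f2pos := hW.f2pos
  f2 := hW.f2
  f3init j := by
    by_cases hj : j = 0
    · subst hj; exact h0i
    · exact hW.f3init j hj
  f3 j := by
    by_cases hj : j = 0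
    · subst hj; exact h0
    · exact hW.f3 j hj

/-- The composite cell keeps the record's scalar consequences: `Γ₂ > 0`. [folklore] -/
theorem ClosesWBX.Gamma2_pos {pieces : State → ℕ → ℝ} {M : ℕ} {y : State} {c₆ : ℝ}
    (hW : Φ.ClosesWBX pieces M y c₆) : 0 < y.Gamma2 :=
  zero_lt_one.trans hW.one_lt_Gamma2

/-- `B6` is monotone in the new constant `c₆` (at states with `z_o ≥ 0`, e.g. above a floor with `Γ₁ ≥ 0`, `d ≥ 2`). [folklore] -/
theorem B6_mono_c {pieces : State → ℕ → ℝ} {M : ℕ} {y : State} {c₆ c₆' : ℝ} (hz : 0 ≤ 2 * Φ.d * Φ.zo y)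
    (h : c₆ ≤ c₆') : Φ.B6 pieces M y c₆ ≤ Φ.B6 pieces M y c₆' := by
  unfold B6
  gcongr

/-- `B6` is monotone in the explicit pieces. [folklore] -/
theorem B6_mono_pieces {pieces pieces' : State → ℕ → ℝ} {M : ℕ} {y : State} {c₆ : ℝ} (hz : 0 ≤ 2 * Φ.d * Φ.zo y)
    (h : ∀ i ∈ Finset.Icc 6 M, pieces y i ≤ pieces' y i) : Φ.B6 pieces M y c₆ ≤ Φ.B6 pieces' M y c₆ := by
  unfold B6
  gcongr with i hi
  exact h i hi

/-- MONOTONICITY of the minorant cell of the new triple between comparable points of the cone whose upper point is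
admissible — the `cells_mono` pattern of `NoGoFrame.Frame.T'_mono` for one more `boundFThreeMono` pair. [folklore] -/
theorem cellLast'_mono (H : Φ.Hyp y₀) {AF : State → ℝ} (hAF : Φ.AFHyp y₀ m₂ AF) (M : ℕ) {x y : State}
    (hx : y₀ ≤ x) (hxy : x ≤ y) (hA : Φ.Adm m₂ y) : Φ.cellLast' AF M x ≤ Φ.cellLast' AF M y := by
  have hy : y₀ ≤ y := le_trans hx hxy
  have hτ := H.tables
  have hAx := adm_down H hx hxy hA
  have hAFx : 0 ≤ AF x := hAF.floor_nonneg.trans (hAF.mono le_rfl hx hAx)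
  have hAFy : 0 ≤ AF y := hAFx.trans (hAF.mono hx hxy hA)
  have WAx := argsWith_WF H hx hAx hAFx
  have WAy := argsWith_WF H hy hA hAFy
  have DA := argsWith_dom H hx hxy hA (hAF.mono hx hxy hA)
  unfold cellLast'
  exact min_le_min (boundFThreeMono_mono hτ WAx WAy DA _ _ _ _) (boundFThreeMono_mono hτ WAx WAy DA _ _ _ _)

/-- The minorant cell is below the notebook cell on admissible points of the cone (`T'_le_T` pattern). [folklore] -/
theorem cellLast'_le_cellLast (H : Φ.Hyp y₀) {AF : State → ℝ} (hAF : Φ.AFHyp y₀ m₂ AF) (M : ℕ) {y : State}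
    (hy : y₀ ≤ y) (hA : Φ.Adm m₂ y) : Φ.cellLast' AF M y ≤ Φ.cellLast M y := by
  have hτ := H.tables
  have hAF0 : 0 ≤ AF y := hAF.floor_nonneg.trans (hAF.mono le_rfl hy hA)
  have hAFle := hAF.le hy hA
  have Wv := argsWith_WF H hy hA hAF0
  have Wt := argsWith_WF H hy hA (hAF0.trans hAFle)
  have Dv : (Φ.argsWith y (AF y)).Dom (Φ.argsWith y (Φ.exAt y Pt.o 1)) := argsWith_dom H hy le_rfl hA hAFle
  unfold cellLast' cellLast
  exact min_le_min
    ((boundFThreeMono_mono hτ Wv Wt Dv _ _ _ _).trans (boundFThreeMono_le hτ Wt _ _ _ _))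
    ((boundFThreeMono_mono hτ Wv Wt Dv _ _ _ _).trans (boundFThreeMono_le hτ Wt _ _ _ _))

/-- ESCAPE OF THE NEW CELL ALONE: if along the cone the minorant cell of the new triple already exceeds the candidate
constant `c₆` at an admissible point `y ≥ y₀`, then `(y, c₆)` does not close the composite cell. [folklore] -/
theorem not_closesWBX_of_cellLast'_ge (H : Φ.Hyp y₀) {AF : State → ℝ} (hAF : Φ.AFHyp y₀ m₂ AF)
    {pieces : State → ℕ → ℝ} {M : ℕ} {y : State} {c₆ : ℝ} (hy : y₀ ≤ y) (hA : Φ.Adm m₂ y)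
    (hesc : c₆ ≤ Φ.cellLast' AF M y) : ¬ Φ.ClosesWBX pieces M y c₆ := fun hW =>
  (lt_irrefl c₆) (lt_of_le_of_lt (hesc.trans (cellLast'_le_cellLast H hAF M hy hA)) hW.f3Last)

end Proofs

end Frame

end NoGoFrame

end Literature.Probability.FitznerVanDerHofstad2017
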